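import Summits.ResolutionOfSingularities.ResolutionOfSingularities.Theorems.MarkedTransferCampaignW31UscHolds
import Summits.ResolutionOfSingularities.ResolutionOfSingularities.Theorems.MarkedTransferCampaignW36ClassInhabitants
import Literature.AlgebraicGeometry.Hironaka2017.Proofs.S06BaseHike.Thm614Part1At
import HarnessLib

/-!
# [OURS · L1 W3.1/W3.6 ↔ GAP-LEDGER R20] THE BINDER BRIDGE: at the (43)-object `Ě`, the D-lane's instance-level modulus
# ⟨SingRegular(Ě)⟩ («`Sing(Ě)` reduced is regular», p493712 / p495052 / p496353) IS slot W3.1's regular residual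
# ⟨HatClosureRegular⟩ («`Σ̄_max(Ê)` reduced is regular», p476257 / p480937) — kernel `Iff`, class by class; the class-restricted OURS
# Props `CampaignW36.HatClosureRegularOn 𝒞` / `CoreFocusSingRegularOn 𝒞`, the class `RegularClosureClass`, and their `p`-slices

Cell `res-hironaka` (run/shared/lean/pub/res-hironaka/), rung L (rescue) of LADDER-RESOLUTION, row L-G3 (datum `Ě`), slots W3.1 (u.s.c.
first; slot statement PROVED p491140) and W3.6 (door PROVED on `𝒞 = LCIOrMonomialClass`, p494780; «𝒞 ⊇ regular cuts» K-1…K-4, p497030).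
Typed by the OURS typer o4 (statement-only lane; typer of record of p476257 / p480937 / p485977 / p487786 / p488503). HOST (custody, no
new route): `--supports stmt-ResolutionOfSingularities-16155 --as helper`, as every `MarkedTransferCampaignW31*/W36*` file. A `Literature.*`
module cannot import a `Summits.*` module, so this identification of a Summits-side named residual with a Literature-side hypothesis shape
can only be recorded here.

WHY (records on the cell's STATUS.md): the G3 lead (res-adj-3) words GAP-LEDGER R20 sub 20a (Th. 6.14 (1)), 20c|(56″) and Th. 6.14 (2″)
AT THE (43)-OBJECT as FOLLOWS-MODULO the ONE instance-level premise ⟨SingRegular(Ě)⟩ := `Scheme.IsRegular (vanishingIdeal ⟨Ě.sing,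
A.isClosed_sing Ě⟩).subscheme` (2026-08-27T04:12:28Z / 04:23:41Z / 04:33:13Z; kernels `S06BaseHike.Thm6_14_1_of_isRegular_sing` p493712,
`Eq56_prod_ours_of_isCoreFocus_of_regular` p495052, `Thm6_14_prop2_prod_ours_of_isCoreFocus_of_regular` p496353 — all take `hreg` in
exactly that shape), «counted once at root R12», and two seats (director 04:30:38Z: s36-pv-3 / s36-pv-4) decide it at a SINGULAR top
stratum INSIDE the door's class. On the L side the regularity premise of record is W3.1's ⟨HatClosureRegular⟩ =
`CampaignW31.InvmaxClosureRegularOn (Sing(Ê)_cl) (Inv(Ê))` (family Props `CampaignW31.HatClosureRegular(Pos)`, slices `…Regular(Pos)I p`).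
THIS FILE records, as kernel facts over OUR typed carriers, that the two premises are ONE, and re-keys the regular door as a CLASS theorem:
* §1 `CampaignW31.invmaxClosure_eq_sing_of_isCoreFocus` — for EVERY typed core focus `Ě` of `Ê` (any reading `inv`; res-type-076's
  `Lib/CoreFocusPAlg.sing_eq_closure_invmaxStratum_of_isCoreFocus` as an equality of `Closeds`): `Σ̄_max(Ê) = ⟨Sing Ě⟩`; hence
  `invmaxClosureRegularOn_iff_isRegular_sing_of_isCoreFocus` (⟨HatClosureRegular⟩ at `(Ê, inv)` ⟺ ⟨SingRegular(Ě)⟩), the ORD-POW residual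
  likewise (`ordPowAlong_invmaxClosure_iff_of_isCoreFocus`), and `_inst` forms at row 010d's instantiation (`IsCoreFocus_inst`, `invField`).
* §2 class-restricted OURS Props in the W3.6 idiom of p487786 (class `𝒞 : (Ê, Σ_max) ↦ Prop`, provenance `IsEdgeData`, guard `0 < Ê.b`):
  `CampaignW36.HatClosureRegularOn 𝒞` (= `CampaignW31.HatClosureRegularPos` on the class; `⊤ ↔ …Pos`) and `CoreFocusSingRegularOn 𝒞`
  (member by member in `(A, E, ed)` guarded by `𝒞`: an `Ě` EXISTS with regular `Sing(Ě)` — the hypothesis of the three D-lane kernels); THE BRIDGE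
  `coreFocusSingRegularOn_iff_hatClosureRegularOn_of_hatUscCutOn` (given ⟨UscCut⟩ on `𝒞`, which FOLLOWS on every class from W3.1); on
  `HatClosureRegularOn 𝒞`-data EVERY typed core focus has regular `Sing(Ě)` and `℘(Ě, a) = 𝓘_{Σ̄_max(Ê)}^a` for all `a` (over p493712).
* §2b the class `CampaignW36.RegularClosureClass` («`Σ̄` reduced is regular»; at `Σ_max` it IS `InvmaxClosureRegularOn`, `Iff.rfl`): the
  regularity premise as a per-`(E, ed)` CLASS GUARD, never a blanket ∀E premise (the L-side analogue of p493712's instance-level repair of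
  `RegularCut_ours`); inside `LCIOrMonomialClass` by K-3 (p497030); the W3.1 regular door = the W3.6 door restricted (K-4's payoff as a
  theorem about the apex Props).
* §3 `p`-slices, UNCONDITIONAL (W3.1 p491140): `campaignW36CoreFocusSingRegularOnI_iff 𝒞 p : …SingRegularOnI 𝒞 p ↔ …HatClosureRegularOnI 𝒞 p`
  for EVERY class; `… ⊤ p ↔ CampaignW31HatClosureRegularPosI p` (§M: binders «R12:HatClosureRegular(Pos)» ≡ «R20:SingRegular(Ě)» at the
  (43)-object); on `RegularClosureClass` the apex with regular `Sing(Ě)` HOLDS OUTRIGHT (`…SingRegularOnI_regularClosure_holds`).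
So res-adj-3's split of 20a reads BY NAME «FOLLOWS on `RegularClosureClass`-data (binder-free); open/negative exactly where `Σ̄_max(Ê)` is
singular (SEAT 1)». Nothing CANDIDATE is discharged: ⟨HatClosureRegular⟩ on a class with singular strata stays the premise it was.

HONEST FRAMING. Every declaration below is OURS (a campaign statement about OUR typed objects) or kernel plumbing over typed carriers;
NOTHING here is a statement of H. Hironaka's manuscript (2017-03-23, [Hironaka2017], lit key `paper:url-3343fd9e678b`), nothing asserts
that any statement of it holds, and no regularity of `Sing(Ě)` or of `Σ̄_max(Ê)` is printed anywhere in §6 (pp. 29–34) — both are OUR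
premises. The typed candidates `IsCoreFocus(_inst)`, `baseHike`, `EdgeDataOn`, `IsEdgeDataOn`, `invField`/`invInst`, `S04CharAlgebra.pAlg`
(rows 003/009/010) are carriers / hypotheses only. AI typing, weaker than expert review.

## Vacuity self-check (T-lint; for the lanes)
* `HatClosureRegularOn 𝒞` / `CampaignW36HatClosureRegularOnI 𝒞 p`: NOT trivially true (regularity of the reduced structure on a
  positive-dimensional `Σ̄_max` is a genuine condition; res-adj-3's UNCERTIFIED candidate `((z² + x³y³), 2)` on `𝔸³_{𝔽₂}` would have `Σ̄_max` =
  the cross `{z = 0, xy = 0}`, singular, INSIDE `LCIClass`); NOT trivially false (finite `Σ_max` of closed points, the K3.1 witnesses); on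
  `𝒞 = RegularClosureClass` it holds BY DEFINITION (disclosed: the guard is the conclusion) — the content there is the EXISTENCE theorem.
  Vacuous exactly where the Hat family is (no standard `E` with `0 < Ê.b` in the class / no certified family) — as on p480937 / p487786.
* `CoreFocusSingRegularOn 𝒞` / `…OnI 𝒞 p`: EQUIVALENT to the former given ⟨UscCut⟩ (this file); demands an actual `Ě`.
* `RegularClosureClass`: neither empty (finite strata) nor everything (singular curves); definitional twin of `InvmaxClosureRegularOn` at
  `Σ_max`, typed separately only because the W3.6 class idiom takes `(F, Σ)`, not `(S, f)`.
* The `Iff`s are not definitional: «⇐» uses (43) + Jacobson density, «⇒» uses res-type-010's cut-down `Ě` (p480937) and ⟨UscCut⟩.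

Reference (context only, not a premise): H. Hironaka, ms. 2017-03-23, §6.2 p.30 l.4–9 Eq. (43); §6.3 Th. 6.14 p.34 l.11–22. [Hironaka2017]
-/

noncomputable section

set_option linter.dupNamespace false -- mandated namespace of this single-conjunct summit

open _root_.AlgebraicGeometry _root_.TopologicalSpace

namespace Summit.ResolutionOfSingularities.ResolutionOfSingularities.Theorems

open Literature.AlgebraicGeometry.Resolution Literature.AlgebraicGeometry.Hironaka2017
open Literature.AlgebraicGeometry.Hironaka2017.S02Preliminaries Literature.AlgebraicGeometry.Hironaka2017.S04CharAlgebra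
open Literature.AlgebraicGeometry.Hironaka2017.S06BaseHike Literature.AlgebraicGeometry.Hironaka2017.Datum
open Scheme.IdealSheafData

universe u

/-! ## 1. Per instance: `Σ̄_max(Ê) = Sing(Ě)` as closed sets, for every typed core focus (any reading `inv`) -/

namespace CampaignW31

section PerInstance

variable {p : ℕ} [Fact p.Prime] {K : Type u} [Field K] [CharP K p] {n : ℕ}

/-- **`Σ̄_max(Ê) = ⟨Sing Ě⟩` in `Closeds A.Z`** for every typed core focusing `Ě` of `Ê` on the ambient datum, ANY reading `inv`
(res-type-076's `sing_eq_closure_invmaxStratum_of_isCoreFocus`: (43) + `Sing(Ě)` closed + Jacobson density, read through p476257's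
`CampaignW31.invmaxClosure := Closeds.closure Σ_max`). Kernel plumbing over typed carriers; NOT a statement of the manuscript. [folklore] -/
theorem invmaxClosure_eq_sing_of_isCoreFocus (A : AmbientDatum p K) (inv : IdealExponent A.Z → A.Z → EdgeInv n)
    (Ehat : IdealExponent A.Z) {Echeck : IdealExponent A.Z} (h : IsCoreFocus S04CharAlgebra.pAlg inv Ehat Echeck) :
    invmaxClosure (Ehat.sing ∩ S02Preliminaries.closedPoints A.Z) (inv Ehat) = ⟨Echeck.sing, A.isClosed_sing Echeck⟩ := by
  apply Closeds.ext
  show closure _ = Echeck.sing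
  exact (sing_eq_closure_invmaxStratum_of_isCoreFocus A inv Ehat h).symm

/-- **⟨HatClosureRegular⟩ at `(Ê, inv)` ⟺ ⟨SingRegular(Ě)⟩** for every typed core focusing `Ě` of `Ê` (any `inv`): W3.1's regular
residual `CampaignW31.InvmaxClosureRegularOn (Sing(Ê)_cl) (inv Ê)` («`Σ̄_max(Ê)` reduced is regular») IS the D-lane's instance-level
modulus `Scheme.IsRegular (vanishingIdeal ⟨Ě.sing, A.isClosed_sing Ě⟩).subscheme` (hypothesis `hreg` of p493712 / p495052 / p496353,
verbatim shape). Kernel plumbing; NOT a statement of the manuscript. [folklore] -/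
theorem invmaxClosureRegularOn_iff_isRegular_sing_of_isCoreFocus (A : AmbientDatum p K)
    (inv : IdealExponent A.Z → A.Z → EdgeInv n) (Ehat : IdealExponent A.Z) {Echeck : IdealExponent A.Z}
    (h : IsCoreFocus S04CharAlgebra.pAlg inv Ehat Echeck) :
    InvmaxClosureRegularOn (Ehat.sing ∩ S02Preliminaries.closedPoints A.Z) (inv Ehat) ↔
      Scheme.IsRegular (vanishingIdeal (⟨Echeck.sing, A.isClosed_sing Echeck⟩ : Closeds A.Z)).subscheme := by
  unfold InvmaxClosureRegularOn
  rw [invmaxClosure_eq_sing_of_isCoreFocus A inv Ehat h]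

/-- **The ORD-POW residual reads on `Sing(Ě)` too**: `OrdPowAlong Σ̄_max(Ê) ↔ OrdPowAlong ⟨Sing Ě⟩` for every typed core focusing
(any `inv`). Kernel plumbing; NOT a statement of the manuscript. [folklore] -/
theorem ordPowAlong_invmaxClosure_iff_of_isCoreFocus (A : AmbientDatum p K) (inv : IdealExponent A.Z → A.Z → EdgeInv n)
    (Ehat : IdealExponent A.Z) {Echeck : IdealExponent A.Z} (h : IsCoreFocus S04CharAlgebra.pAlg inv Ehat Echeck) :
    OrdPowAlong (invmaxClosure (Ehat.sing ∩ S02Preliminaries.closedPoints A.Z) (inv Ehat)) ↔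
      OrdPowAlong (⟨Echeck.sing, A.isClosed_sing Echeck⟩ : Closeds A.Z) := by
  rw [invmaxClosure_eq_sing_of_isCoreFocus A inv Ehat h]

/-- `_inst` form (row 010d's instantiation of record `IsCoreFocus_inst Ê Ě ed`, reading `invField Ê ed`): `Σ̄_max(Ê) = ⟨Sing Ě⟩`.
Kernel plumbing; NOT a statement of the manuscript. [folklore] -/
theorem invmaxClosure_eq_sing_of_isCoreFocus_inst (A : AmbientDatum p K) (Ehat : IdealExponent A.Z)
    (ed : EdgeDataOn p n Ehat) {Echeck : IdealExponent A.Z} (h : IsCoreFocus_inst Ehat Echeck ed) :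
    invmaxClosure (Ehat.sing ∩ S02Preliminaries.closedPoints A.Z) (invField Ehat ed) =
      ⟨Echeck.sing, A.isClosed_sing Echeck⟩ :=
  invmaxClosure_eq_sing_of_isCoreFocus A (invInst Ehat ed) Ehat h

/-- `_inst` form: ⟨HatClosureRegular⟩ at `(Ê, ed)` ⟺ ⟨SingRegular(Ě)⟩, for every `Ě` with `IsCoreFocus_inst Ê Ě ed`. Kernel plumbing;
NOT a statement of the manuscript. [folklore] -/
theorem invmaxClosureRegularOn_iff_isRegular_sing_of_isCoreFocus_inst (A : AmbientDatum p K) (Ehat : IdealExponent A.Z)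
    (ed : EdgeDataOn p n Ehat) {Echeck : IdealExponent A.Z} (h : IsCoreFocus_inst Ehat Echeck ed) :
    InvmaxClosureRegularOn (Ehat.sing ∩ S02Preliminaries.closedPoints A.Z) (invField Ehat ed) ↔
      Scheme.IsRegular (vanishingIdeal (⟨Echeck.sing, A.isClosed_sing Echeck⟩ : Closeds A.Z)).subscheme :=
  invmaxClosureRegularOn_iff_isRegular_sing_of_isCoreFocus A (invInst Ehat ed) Ehat h

end PerInstance

end CampaignW31

/-! ## 2. On a class `𝒞`: the class-restricted regular residual and «`Ě` exists with regular `Sing(Ě)`» -/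

namespace CampaignW36

section OnClass

variable (𝒞 : ∀ ⦃W : Scheme.{u}⦄, IdealExponent W → Set W → Prop)
  (IsEdgeData : ∀ ⦃X : Scheme.{u}⦄ ⦃p n : ℕ⦄ (E : IdealExponent X) (ξ : X), EdgeDatumAt p n E ξ → Prop)

/-- **[OURS · L1 W3.1/W3.6] `CampaignW36.HatClosureRegularOn 𝒞` — the REGULAR RESIDUAL ⟨HatClosureRegular⟩ ON THE CLASS `𝒞`**:
replaces the role of NOTHING printed (no argument for the existence of `Ě`, p.30 l.4–9, and no regularity of the closure of the
`Inv_max`-stratum appear in the manuscript); NOT a statement of the manuscript. Binders of the W3.6 Hat-on-class family (p487786): for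
every standard `E` on `A.Z` with `0 < Ê.b` (`Ê = baseHike E`), every certified family `ed` of edge data of `Ê` on `Sing(Ê)_cl`, IF
`𝒞 Ê Σ_max` (`Σ_max = invmaxStratum (Sing(Ê)_cl) (invField Ê ed)`) THEN the closure `Σ̄_max(Ê)` with its reduced closed-subscheme structure
is REGULAR (`CampaignW31.InvmaxClosureRegularOn`). `CampaignW31.HatClosureRegularPos` (p480937) is the class `⊤`
(`hatClosureRegularOn_univ_iff`). A predicate on `(A, E, ed)` guarded by `𝒞`, universally closed over the class: a HYPOTHESIS row (refutable by
one member with singular `Σ̄_max`), never a modulus of record (res-adj-3 04:12:28Z / 04:56:11Z (R2)); CANDIDATE on any class with such a member. [folklore] -/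
def HatClosureRegularOn {p : ℕ} [Fact p.Prime] {K : Type u} [Field K] [CharP K p] [PerfectField K] (A : AmbientDatum p K)
    (n : ℕ) : Prop :=
  ∀ (E : IdealExponent A.Z) (ed : EdgeDataOn p n (baseHike E)), E.IsStandard → 0 < (baseHike E).b →
    IsEdgeDataOn IsEdgeData (baseHike E) ed →
    𝒞 (baseHike E) (invmaxStratum ((baseHike E).sing ∩ S02Preliminaries.closedPoints A.Z) (invField (baseHike E) ed)) →
      CampaignW31.InvmaxClosureRegularOn ((baseHike E).sing ∩ S02Preliminaries.closedPoints A.Z) (invField (baseHike E) ed)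

/-- **[OURS · L1 W3.6 ↔ R20] `CampaignW36.CoreFocusSingRegularOn 𝒞` — «ON THE CLASS, THE (43)-OBJECT EXISTS WITH REGULAR SINGULAR
LOCUS»**: replaces the role of the unproved existence sentence p.30 l.5–9 TOGETHER WITH the unprinted regularity premise that the
D-lane's kernels for Th. 6.14 (1) / (56″) / Th. 6.14 (2″) consume (⟨SingRegular(Ě)⟩, p493712 / p495052 / p496353); NOT a statement of
the manuscript. Same binders as `CoreFocusExistsOn 𝒞` (p487786): for every standard `E` with `0 < Ê.b`, every certified `ed`, if
`𝒞 Ê Σ_max` then there IS an `Ě` with `IsCoreFocus ℘ (invInst Ê ed) Ê Ě` (row 010d's conclusion) whose reduced `Sing(Ě)` is regular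
(`Scheme.IsRegular (vanishingIdeal ⟨Ě.sing, A.isClosed_sing Ě⟩).subscheme`, the D-lane's hypothesis shape verbatim). EQUIVALENT to
`HatClosureRegularOn 𝒞` given ⟨UscCut⟩ (`coreFocusSingRegularOn_iff_hatClosureRegularOn_of_hatUscCutOn`), read member by member in `(A, E, ed)`;
like it a HYPOTHESIS row over the class, never a modulus of record; CANDIDATE content = that of the regular residual. [folklore] -/
def CoreFocusSingRegularOn {p : ℕ} [Fact p.Prime] {K : Type u} [Field K] [CharP K p] [PerfectField K] (A : AmbientDatum p K)
    (n : ℕ) : Prop :=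
  ∀ (E : IdealExponent A.Z) (ed : EdgeDataOn p n (baseHike E)), E.IsStandard → 0 < (baseHike E).b →
    IsEdgeDataOn IsEdgeData (baseHike E) ed →
    𝒞 (baseHike E) (invmaxStratum ((baseHike E).sing ∩ S02Preliminaries.closedPoints A.Z) (invField (baseHike E) ed)) →
      ∃ Echeck : IdealExponent A.Z, IsCoreFocus S04CharAlgebra.pAlg (invInst (baseHike E) ed) (baseHike E) Echeck ∧
        Scheme.IsRegular (vanishingIdeal (⟨Echeck.sing, A.isClosed_sing Echeck⟩ : Closeds A.Z)).subscheme

variable {𝒞 IsEdgeData}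

/-- The blanket guarded residual `CampaignW31.HatClosureRegularPos` (p480937) gives the class-restricted one on EVERY class. [folklore] -/
theorem hatClosureRegularOn_of_hatClosureRegularPos {p : ℕ} [Fact p.Prime] {K : Type u} [Field K] [CharP K p] [PerfectField K]
    {A : AmbientDatum p K} {n : ℕ} (h : CampaignW31.HatClosureRegularPos IsEdgeData A n) : HatClosureRegularOn 𝒞 IsEdgeData A n :=
  fun E ed hE hb hed _ => h E ed hE hb hed

/-- On the class `⊤` the class-restricted residual IS `CampaignW31.HatClosureRegularPos`. [folklore] -/
theorem hatClosureRegularOn_univ_iff {p : ℕ} [Fact p.Prime] {K : Type u} [Field K] [CharP K p] [PerfectField K]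
    {A : AmbientDatum p K} {n : ℕ} :
    HatClosureRegularOn (fun _ _ _ => True) IsEdgeData A n ↔ CampaignW31.HatClosureRegularPos IsEdgeData A n :=
  ⟨fun h E ed hE hb hed => h E ed hE hb hed trivial, fun h => hatClosureRegularOn_of_hatClosureRegularPos h⟩

/-- «`Ě` exists with regular `Sing(Ě)`» on `𝒞` ⇒ the W3.6 apex `CoreFocusExistsOn 𝒞` (p487786) — forget the regularity. [folklore] -/
theorem coreFocusExistsOn_of_coreFocusSingRegularOn {p : ℕ} [Fact p.Prime] {K : Type u} [Field K] [CharP K p] [PerfectField K]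
    {A : AmbientDatum p K} {n : ℕ} (h : CoreFocusSingRegularOn 𝒞 IsEdgeData A n) : CoreFocusExistsOn 𝒞 IsEdgeData A n :=
  fun E ed hE hb hed hC => (h E ed hE hb hed hC).imp fun _ h' => h'.1

/-- **«⇐» of the bridge, NO hypothesis**: «`Ě` exists with regular `Sing(Ě)`» on `𝒞` ⇒ the regular residual on `𝒞`
(`Σ̄_max(Ê) = Sing(Ě)`, §1). [folklore] -/
theorem hatClosureRegularOn_of_coreFocusSingRegularOn {p : ℕ} [Fact p.Prime] {K : Type u} [Field K] [CharP K p] [PerfectField K]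
    {A : AmbientDatum p K} {n : ℕ} (h : CoreFocusSingRegularOn 𝒞 IsEdgeData A n) : HatClosureRegularOn 𝒞 IsEdgeData A n :=
  fun E ed hE hb hed hC => by
    obtain ⟨Echeck, hEc, hreg⟩ := h E ed hE hb hed hC
    exact (CampaignW31.invmaxClosureRegularOn_iff_isRegular_sing_of_isCoreFocus A (invInst (baseHike E) ed) _ hEc).mpr hreg

/-- **On regular-residual data EVERY typed core focus has regular `Sing(Ě)`** (not only the cut-down one): `HatClosureRegularOn 𝒞` ⇒ for
every `(E, ed)` in the class and every `Ě` with `IsCoreFocus ℘ (invInst Ê ed) Ê Ě`, ⟨SingRegular(Ě)⟩ in the D-lane's shape. [folklore] -/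
theorem isRegular_sing_of_hatClosureRegularOn {p : ℕ} [Fact p.Prime] {K : Type u} [Field K] [CharP K p] [PerfectField K]
    {A : AmbientDatum p K} {n : ℕ} (h : HatClosureRegularOn 𝒞 IsEdgeData A n) (E : IdealExponent A.Z)
    (ed : EdgeDataOn p n (baseHike E)) (hE : E.IsStandard) (hb : 0 < (baseHike E).b) (hed : IsEdgeDataOn IsEdgeData (baseHike E) ed)
    (hC : 𝒞 (baseHike E) (invmaxStratum ((baseHike E).sing ∩ S02Preliminaries.closedPoints A.Z) (invField (baseHike E) ed)))
    {Echeck : IdealExponent A.Z} (hEc : IsCoreFocus S04CharAlgebra.pAlg (invInst (baseHike E) ed) (baseHike E) Echeck) :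
    Scheme.IsRegular (vanishingIdeal (⟨Echeck.sing, A.isClosed_sing Echeck⟩ : Closeds A.Z)).subscheme :=
  (CampaignW31.invmaxClosureRegularOn_iff_isRegular_sing_of_isCoreFocus A (invInst (baseHike E) ed) (baseHike E) hEc).mp
    (h E ed hE hb hed hC)

/-- **«⇒» of the bridge, given ⟨UscCut⟩ on the class**: ⟨UscCut⟩ on `𝒞` (`HatUscCutOn`, p487786 — FOLLOWS on every class from slot W3.1)
∧ the regular residual on `𝒞` ⇒ «`Ě` exists with regular `Sing(Ě)`» on `𝒞`: the witness is res-type-010's cut-down `cutDown Ê Σ̄_max`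
(`CampaignW31.isCoreFocus_cutDown_of_closed_of_regular`, p480937), whose `Sing` is `Σ̄_max` (§1). [folklore] -/
theorem coreFocusSingRegularOn_of_hatUscCutOn_of_hatClosureRegularOn {p : ℕ} [Fact p.Prime] {K : Type u} [Field K] [CharP K p]
    [PerfectField K] {A : AmbientDatum p K} {n : ℕ} (hU : HatUscCutOn 𝒞 IsEdgeData A n) (h : HatClosureRegularOn 𝒞 IsEdgeData A n) :
    CoreFocusSingRegularOn 𝒞 IsEdgeData A n := by
  intro E ed hE hb hed hC
  have hreg := h E ed hE hb hed hC
  have hcl : CampaignW31.StratumRelClosedOn ((baseHike E).sing ∩ S02Preliminaries.closedPoints A.Z) (invField (baseHike E) ed) :=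
    ⟨closure (invmaxStratum ((baseHike E).sing ∩ S02Preliminaries.closedPoints A.Z) (invField (baseHike E) ed)), isClosed_closure,
      (hU E ed hE hb hed hC).symm⟩
  have hcf := CampaignW31.isCoreFocus_cutDown_of_closed_of_regular A E ed hb hcl hreg
  exact ⟨_, hcf,
    (CampaignW31.invmaxClosureRegularOn_iff_isRegular_sing_of_isCoreFocus A (invInst (baseHike E) ed) (baseHike E) hcf).mp hreg⟩

/-- **THE BRIDGE on a class, given ⟨UscCut⟩ on it**: `CoreFocusSingRegularOn 𝒞 ↔ HatClosureRegularOn 𝒞`. [folklore] -/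
theorem coreFocusSingRegularOn_iff_hatClosureRegularOn_of_hatUscCutOn {p : ℕ} [Fact p.Prime] {K : Type u} [Field K] [CharP K p]
    [PerfectField K] {A : AmbientDatum p K} {n : ℕ} (hU : HatUscCutOn 𝒞 IsEdgeData A n) :
    CoreFocusSingRegularOn 𝒞 IsEdgeData A n ↔ HatClosureRegularOn 𝒞 IsEdgeData A n :=
  ⟨hatClosureRegularOn_of_coreFocusSingRegularOn, coreFocusSingRegularOn_of_hatUscCutOn_of_hatClosureRegularOn hU⟩

/-- **PAYOFF with the D-lane (res-D-pv-027 p493712): on regular-residual data the (43)-object is DETERMINED — `℘(Ě, a) = 𝓘_{Σ̄_max(Ê)}^a`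
for every `a`** — stated with p493712's binder list VERBATIM (`E` standard, `hEc : IsCoreFocus_inst (baseHike E) Ě ed`, the instantiation of
record; `CoreFocusExistsOn`'s conclusion `IsCoreFocus ℘ (invInst Ê ed) Ê Ě` is this by `rfl`) over
`S06BaseHike.pAlg_eq_vanishingIdeal_sing_pow_of_isCoreFocus_inst`, its `hreg` supplied by §1. Kernel composition; NOT a statement of the
manuscript. [folklore] -/
theorem pAlg_eq_vanishingIdeal_invmaxClosure_pow_of_hatClosureRegularOn {p : ℕ} [Fact p.Prime] {K : Type u} [Field K]
    [CharP K p] [PerfectField K] {A : AmbientDatum p K} {n : ℕ} (h : HatClosureRegularOn 𝒞 IsEdgeData A n) (E : IdealExponent A.Z)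
    (ed : EdgeDataOn p n (baseHike E)) (hE : E.IsStandard) (hb : 0 < (baseHike E).b) (hed : IsEdgeDataOn IsEdgeData (baseHike E) ed)
    (hC : 𝒞 (baseHike E) (invmaxStratum ((baseHike E).sing ∩ S02Preliminaries.closedPoints A.Z) (invField (baseHike E) ed)))
    {Echeck : IdealExponent A.Z} (hEc : IsCoreFocus_inst (baseHike E) Echeck ed) (a : ℕ) :
    S04CharAlgebra.pAlg Echeck a =
      vanishingIdeal (CampaignW31.invmaxClosure ((baseHike E).sing ∩ S02Preliminaries.closedPoints A.Z) (invField (baseHike E) ed)) ^ a := by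
  rw [CampaignW31.invmaxClosure_eq_sing_of_isCoreFocus_inst A (baseHike E) ed hEc]
  exact pAlg_eq_vanishingIdeal_sing_pow_of_isCoreFocus_inst A E hE ed Echeck hEc
    (isRegular_sing_of_hatClosureRegularOn h E ed hE hb hed hC hEc) a

end OnClass

/-! ## 2b. The class of REGULAR top strata: the regular residual as a class guard (instance-level, never a blanket ∀E premise) -/

section RegularClass

/-- **[OURS · L1 W3.1/W3.6] the class `CampaignW36.RegularClosureClass`** — `(F, Σ) ↦` «the closure `Σ̄` of the stratum `Σ`, with its
reduced closed-subscheme structure, is REGULAR» (`Scheme.IsRegular (vanishingIdeal (Closeds.closure Σ)).subscheme`). Replaces the role of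
nothing printed; NOT a statement of the manuscript. At `Σ = invmaxStratum S f` it is LITERALLY W3.1's `CampaignW31.InvmaxClosureRegularOn S f`
(`regularClosureClass_iff`, `Iff.rfl`), so «`Σ̄_max(Ê)` regular» becomes a CLASS GUARD read per `(E, ed)` — the L-side analogue of the
D-lane's instance-level ⟨SingRegular(Ě)⟩ (p493712's repair of the blanket `RegularCut_ours`): no theorem on this class is vacuous at an
ambient datum merely because SOME OTHER exponent has a singular top stratum. By res-type-012's K-3 (p497030) it lies inside the W3.6 door's
class `LCIOrMonomialClass` on every ambient datum (`lciOrMonomialClass_of_regularClosureClass`). [folklore] -/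
def RegularClosureClass ⦃W : Scheme.{u}⦄ (_ : IdealExponent W) (Sig : Set W) : Prop :=
  Scheme.IsRegular (vanishingIdeal (Closeds.closure Sig)).subscheme

/-- `RegularClosureClass F (invmaxStratum S f)` IS `CampaignW31.InvmaxClosureRegularOn S f` (definitional). [folklore] -/
theorem regularClosureClass_iff {W : Scheme.{u}} {n : ℕ} (F : IdealExponent W) (S : Set W) (f : W → EdgeInv n) :
    RegularClosureClass F (invmaxStratum S f) ↔ CampaignW31.InvmaxClosureRegularOn S f :=
  Iff.rfl

/-- **«regular top strata ⊆ 𝒞»** on every ambient datum (res-type-012's K-3 `lciOrMonomialClass_of_invmaxClosureRegularOn`, p497030, by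
name): the regular-closure class lies inside the W3.6 door's class `LCIOrMonomialClass`. [folklore] -/
theorem lciOrMonomialClass_of_regularClosureClass {p : ℕ} [Fact p.Prime] {K : Type u} [Field K] [CharP K p] (A : AmbientDatum p K)
    {n : ℕ} (F : IdealExponent A.Z) (S : Set A.Z) (f : A.Z → EdgeInv n) (h : RegularClosureClass F (invmaxStratum S f)) :
    LCIOrMonomialClass F (invmaxStratum S f) :=
  lciOrMonomialClass_of_invmaxClosureRegularOn A F S f h

variable {IsEdgeData : ∀ ⦃X : Scheme.{u}⦄ ⦃p n : ℕ⦄ (E : IdealExponent X) (ξ : X), EdgeDatumAt p n E ξ → Prop}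

/-- The regular residual ON THE REGULAR-CLOSURE CLASS holds by definition (the guard is the conclusion). [folklore] -/
theorem hatClosureRegularOn_regularClosureClass {p : ℕ} [Fact p.Prime] {K : Type u} [Field K] [CharP K p] [PerfectField K]
    {A : AmbientDatum p K} {n : ℕ} : HatClosureRegularOn RegularClosureClass IsEdgeData A n :=
  fun _ _ _ _ _ hC => hC

/-- **«`Ě` exists with regular `Sing(Ě)`» ON THE REGULAR-CLOSURE CLASS, given ⟨UscCut⟩ on it** — the REGULAR DOOR of W3.1 restated as a
class theorem with the regularity premise as an instance-level guard. [folklore] -/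
theorem coreFocusSingRegularOn_regularClosureClass_of_hatUscCutOn {p : ℕ} [Fact p.Prime] {K : Type u} [Field K] [CharP K p]
    [PerfectField K] {A : AmbientDatum p K} {n : ℕ} (hU : HatUscCutOn RegularClosureClass IsEdgeData A n) :
    CoreFocusSingRegularOn RegularClosureClass IsEdgeData A n :=
  coreFocusSingRegularOn_of_hatUscCutOn_of_hatClosureRegularOn hU hatClosureRegularOn_regularClosureClass

/-- **The W3.1 regular door is a COROLLARY of the W3.6 door** (K-4's payoff, now about the apex Props): the apex on `LCIOrMonomialClass`
(PROVED, p494780) gives the apex on `RegularClosureClass`, on every perfect ambient datum (K-3 pointwise). [folklore] -/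
theorem coreFocusExistsOn_regularClosure_of_lciOrMonomial {p : ℕ} [Fact p.Prime] {K : Type u} [Field K] [CharP K p] [PerfectField K]
    {A : AmbientDatum p K} {n : ℕ} (h : CoreFocusExistsOn LCIOrMonomialClass IsEdgeData A n) :
    CoreFocusExistsOn RegularClosureClass IsEdgeData A n :=
  fun E ed hE hb hed hC => h E ed hE hb hed (lciOrMonomialClass_of_invmaxClosureRegularOn A _ _ _ hC)

end RegularClass

end CampaignW36

/-! ## 3. Per-`p` slices at row 005 part b's provenance `CampaignW31.edgeDataProvenance` (class stays a parameter) -/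

open CampaignW36

/-- **[OURS · L1 W3.1/W3.6] `CampaignW36HatClosureRegularOnI 𝒞 p`** — `p`-slice of the regular residual ON THE CLASS `𝒞` at
`CampaignW31.edgeDataProvenance`: for every perfect `K` of characteristic `p`, ambient datum `A`, `n`, standard `E` with `0 < Ê.b` and
certified family with `𝒞 Ê Σ_max`, `Σ̄_max(Ê)` (reduced) is regular. Replaces the role of nothing printed; CANDIDATE premise (class `⊤` =
`CampaignW31HatClosureRegularPosI p`, `campaignW36HatClosureRegularOnI_univ_iff`); NOT a statement of the manuscript. [folklore] -/
def CampaignW36HatClosureRegularOnI (𝒞 : ∀ ⦃W : Scheme.{u}⦄, IdealExponent W → Set W → Prop) (p : ℕ) [Fact p.Prime] : Prop :=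
  ∀ (K : Type u) [Field K] [CharP K p] [PerfectField K] (A : AmbientDatum p K) (n : ℕ),
    HatClosureRegularOn 𝒞 CampaignW31.edgeDataProvenance A n

/-- **[OURS · L1 W3.6 ↔ R20] `CampaignW36CoreFocusSingRegularOnI 𝒞 p`** — `p`-slice of «on the class `𝒞` the (43)-object `Ě` EXISTS
with REGULAR `Sing(Ě)`» at `CampaignW31.edgeDataProvenance`. Replaces the role of p.30 l.5–9 on the class together with the unprinted
regularity premise of the Th. 6.14 kernels; CANDIDATE beyond finite strata; NOT a statement of the manuscript. EQUIVALENT, unconditionally,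
to `CampaignW36HatClosureRegularOnI 𝒞 p` (`campaignW36CoreFocusSingRegularOnI_iff`). [folklore] -/
def CampaignW36CoreFocusSingRegularOnI (𝒞 : ∀ ⦃W : Scheme.{u}⦄, IdealExponent W → Set W → Prop) (p : ℕ) [Fact p.Prime] : Prop :=
  ∀ (K : Type u) [Field K] [CharP K p] [PerfectField K] (A : AmbientDatum p K) (n : ℕ),
    CoreFocusSingRegularOn 𝒞 CampaignW31.edgeDataProvenance A n

/-- **THE BRIDGE, `p`-slice, UNCONDITIONAL (slot W3.1 PROVED, p491140)**: for EVERY class `𝒞` and every prime `p`,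
`CampaignW36CoreFocusSingRegularOnI 𝒞 p ↔ CampaignW36HatClosureRegularOnI 𝒞 p` — R20's «`Ě` with regular `Sing(Ě)`» regime and W3.1's
regular residual on the class are ONE named premise (⟨UscCut⟩ from `campaignW31HatStratumClosedPosI_holds`). [folklore] -/
theorem campaignW36CoreFocusSingRegularOnI_iff (𝒞 : ∀ ⦃W : Scheme.{u}⦄, IdealExponent W → Set W → Prop) (p : ℕ) [Fact p.Prime] :
    CampaignW36CoreFocusSingRegularOnI.{u} 𝒞 p ↔ CampaignW36HatClosureRegularOnI.{u} 𝒞 p :=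
  ⟨fun h K _ _ _ A n => hatClosureRegularOn_of_coreFocusSingRegularOn (h K A n), fun h K _ _ _ A n =>
    coreFocusSingRegularOn_of_hatUscCutOn_of_hatClosureRegularOn
      (hatUscCutOn_of_hatStratumClosedPos (campaignW31HatStratumClosedPosI_holds p K A n)) (h K A n)⟩

/-- On the class `⊤` the `p`-slice of the class-restricted residual IS W3.1's `CampaignW31HatClosureRegularPosI p` (p480937). [folklore] -/
theorem campaignW36HatClosureRegularOnI_univ_iff (p : ℕ) [Fact p.Prime] :
    CampaignW36HatClosureRegularOnI.{u} (fun _ _ _ => True) p ↔ CampaignW31HatClosureRegularPosI.{u} p :=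
  ⟨fun h K _ _ _ A n => hatClosureRegularOn_univ_iff.mp (h K A n), fun h K _ _ _ A n => hatClosureRegularOn_univ_iff.mpr (h K A n)⟩

/-- **§M BINDER IDENTITY, blanket form**: «for every standard `E` with `0 < Ê.b` and certified family, `Ě` EXISTS with regular `Sing(Ě)`»
(`CampaignW36CoreFocusSingRegularOnI ⊤ p`) ⟺ W3.1's named regular residual `CampaignW31HatClosureRegularPosI p` — UNCONDITIONALLY. So the
binders «R12:HatClosureRegular(Pos)» and «R20:SingRegular(Ě)» (at the (43)-object) are interchangeable. [folklore] -/
theorem campaignW36CoreFocusSingRegularOnI_univ_iff (p : ℕ) [Fact p.Prime] :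
    CampaignW36CoreFocusSingRegularOnI.{u} (fun _ _ _ => True) p ↔ CampaignW31HatClosureRegularPosI.{u} p :=
  (campaignW36CoreFocusSingRegularOnI_iff _ p).trans (campaignW36HatClosureRegularOnI_univ_iff p)

/-- The `p`-slice of «`Ě` exists with regular `Sing(Ě)`» on `𝒞` gives the W3.6 apex slice `CampaignW36CoreFocusExistsOnI 𝒞 p` (p487786).
[folklore] -/
theorem campaignW36CoreFocusExistsOnI_of_coreFocusSingRegularOnI (𝒞 : ∀ ⦃W : Scheme.{u}⦄, IdealExponent W → Set W → Prop) (p : ℕ)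
    [Fact p.Prime] (h : CampaignW36CoreFocusSingRegularOnI.{u} 𝒞 p) : CampaignW36CoreFocusExistsOnI.{u} 𝒞 p :=
  fun K _ _ _ A n => coreFocusExistsOn_of_coreFocusSingRegularOn (h K A n)

/-- The regular residual's `p`-slice on `𝒞` gives the W3.6 apex slice on `𝒞` — the REGULAR DOOR on any class, binder-free but for the
residual (W3.1 discharged; compare `U30_2_R2_inst_of_closureRegularPos`, p491140, the class-`⊤` form in row 010d's shape).
[folklore] -/
theorem campaignW36CoreFocusExistsOnI_of_hatClosureRegularOnI (𝒞 : ∀ ⦃W : Scheme.{u}⦄, IdealExponent W → Set W → Prop) (p : ℕ)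
    [Fact p.Prime] (h : CampaignW36HatClosureRegularOnI.{u} 𝒞 p) : CampaignW36CoreFocusExistsOnI.{u} 𝒞 p :=
  campaignW36CoreFocusExistsOnI_of_coreFocusSingRegularOnI 𝒞 p ((campaignW36CoreFocusSingRegularOnI_iff 𝒞 p).mpr h)

/-- **Blanket form, binder shape of the D-lane**: W3.1's `CampaignW31HatClosureRegularPosI p` ⇒ for every perfect `K`, `A`, `n`, standard
`E` with `0 < Ê.b`, certified `ed` and EVERY `Ě` with `IsCoreFocus_inst Ê Ě ed`: ⟨SingRegular(Ě)⟩ — the hypothesis `hreg` of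
`S06BaseHike.Thm6_14_1_of_isRegular_sing` (p493712), `Eq56_prod_ours_of_isCoreFocus_of_regular` (p495052) and
`Thm6_14_prop2_prod_ours_of_isCoreFocus_of_regular` (p496353), supplied verbatim. [folklore] -/
theorem isRegular_sing_of_hatClosureRegularPosI (p : ℕ) [Fact p.Prime] (h : CampaignW31HatClosureRegularPosI.{u} p) (K : Type u)
    [Field K] [CharP K p] [PerfectField K] (A : AmbientDatum p K) (n : ℕ) (E : IdealExponent A.Z)
    (ed : EdgeDataOn p n (baseHike E)) (hE : E.IsStandard) (hb : 0 < (baseHike E).b)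
    (hed : IsEdgeDataOn CampaignW31.edgeDataProvenance (baseHike E) ed) {Echeck : IdealExponent A.Z}
    (hEc : IsCoreFocus_inst (baseHike E) Echeck ed) :
    Scheme.IsRegular (vanishingIdeal (⟨Echeck.sing, A.isClosed_sing Echeck⟩ : Closeds A.Z)).subscheme :=
  (CampaignW31.invmaxClosureRegularOn_iff_isRegular_sing_of_isCoreFocus_inst A (baseHike E) ed hEc).mp (h K A n E ed hE hb hed)

/-! ## 3b. UNCONDITIONAL class theorems on `RegularClosureClass` (slot W3.1 discharged; door W3.6 by K-3) -/

/-- **[OURS · L1 W3.1] the regular residual on the regular-closure class HOLDS** (by definition of the guard) — `p`-slice. [folklore] -/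
theorem campaignW36HatClosureRegularOnI_regularClosure_holds (p : ℕ) [Fact p.Prime] :
    CampaignW36HatClosureRegularOnI.{u} RegularClosureClass p :=
  fun _ _ _ _ _ _ => hatClosureRegularOn_regularClosureClass

/-- **[OURS · L1 W3.1/W3.6 ↔ R20, UNCONDITIONAL] on the class of REGULAR top strata the (43)-object EXISTS WITH REGULAR `Sing(Ě)`**:
`CampaignW36CoreFocusSingRegularOnI RegularClosureClass p` for every prime `p` — for every perfect `K`, ambient datum `A`, `n`, standard `E`
with `0 < Ê.b`, certified family `ed` with `Σ̄_max(Ê)` regular, there is a typed core focusing `Ě` of `Ê` (reading `invInst Ê ed`) whose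
reduced `Sing(Ě)` is regular — so the D-lane's Th. 6.14 (1) / (56″) / Th. 6.14 (2″) kernels (p493712 / p495052 / p496353) apply to it with
NO residual binder. This is the instance-guarded, binder-free form of `U30_2_R2_inst_of_closureRegularPos` (p491140, which needs
the BLANKET `CampaignW31HatClosureRegularPosI p`). NOT a statement of the manuscript. [folklore] -/
theorem campaignW36CoreFocusSingRegularOnI_regularClosure_holds (p : ℕ) [Fact p.Prime] :
    CampaignW36CoreFocusSingRegularOnI.{u} RegularClosureClass p :=
  (campaignW36CoreFocusSingRegularOnI_iff _ p).mpr (campaignW36HatClosureRegularOnI_regularClosure_holds p)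

/-- **[OURS · L1 W3.1, UNCONDITIONAL] the W3.6 apex on the regular-closure class**: `CampaignW36CoreFocusExistsOnI RegularClosureClass p` —
«`U30_2_R2_inst` | regular `Σ̄_max`» with the regularity as a per-`(E, ed)` guard, binder-free. Two proofs of record: the cut-down (this
file) and the W3.6 door on `LCIOrMonomialClass` (p494780) with K-3 (p497030) (`coreFocusExistsOn_regularClosure_of_lciOrMonomial`). NOT a
statement of the manuscript. [folklore] -/
theorem campaignW36CoreFocusExistsOnI_regularClosure_holds (p : ℕ) [Fact p.Prime] :
    CampaignW36CoreFocusExistsOnI.{u} RegularClosureClass p :=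
  campaignW36CoreFocusExistsOnI_of_coreFocusSingRegularOnI _ p (campaignW36CoreFocusSingRegularOnI_regularClosure_holds p)

end Summit.ResolutionOfSingularities.ResolutionOfSingularities.Theorems

end
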